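import Mathlib
import HarnessLib
import Summits.Langlands.Langlands.Theses.ParityBlindBianchi
import Summits.Langlands.Langlands.Theses.RuelleTorsionArtinWeight

/-!
# Sketch — crux idea `every-place-by-gamma-rigidity` for stmt-Langlands-15111
(`ParityBlindBianchi.ArtinWeightRealisationLevel`, R′)

First checkable statements of the line "R′ is the shared a.e. crux R plus a rigidity lemma":

* `HypLevel K p σ S₀` — the hypothesis package of R′ verbatim (pinned tame level `S₀ ∋ p`,
  association at EVERY good place);
* `HypAE K p σ` — the hypothesis package of the shared crux R
  (`RuelleTorsionArtinWeight.ArtinWeightRealisation`, stmt-Langlands-11057) verbatim (`∃ S`, places);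
* `LevelToAE` — the bookkeeping transfer `HypLevel → HypAE` (take `S :=` the places of `K` over the
  primes of `S₀`; re-index the eigenvalue family along `{v // v ∉ S} ≃ {v // good v}`);
* `RigidityAE` — THE LEVER: a cuspidal `π` of `GL₂(𝔸_K)` that is Satake–Frobenius compatible with a
  finite-image irreducible `σ` at all but finitely many places is compatible with it at EVERY place
  where `σ` is unramified (quotient of the two global functional equations, stability of `γ`-factors
  under highly ramified twists, archimedean pole exclusion, Jacquet–Langlands Cor. 2.19 local converse);
* `crux_of_rigidity : ArtinWeightRealisation → LevelToAE → RigidityAE → ArtinWeightRealisationLevel`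
  — pure logic, checked: the route-local sharpening R′ costs exactly `RigidityAE` over the shared R.
-/

noncomputable section

open scoped BigOperators Topology Classical Matrix NumberField
open Literature.NumberTheory.Automorphic Literature.NumberTheory.GaloisRepresentations
  IsDedekindDomain NumberField Filter

set_option linter.dupNamespace false
set_option maxHeartbeats 800000

universe u v

/-! ## Re-indexing the generating Hecke family along an equivalence (bookkeeping for `LevelToAE`) -/

namespace Literature.NumberTheory.Automorphic

variable {k : Type u} [CommRing k] {Γ 𝒢 : Type u} [Group Γ] [Group 𝒢]
  (ι : Γ →* 𝒢) (T : LevelTower 𝒢) (ϖ : k) {J J' : Type v}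

theorem towerHeckeAlgebra_comp_equiv (e : J' ≃ J) (δ : J → 𝒢) :
    towerHeckeAlgebra k ι T ϖ (δ ∘ e) = towerHeckeAlgebra k ι T ϖ δ := by
  unfold towerHeckeAlgebra
  congr 1
  ext x
  simp only [Set.mem_range, Function.comp_apply]
  constructor
  · rintro ⟨j, rfl⟩
    exact ⟨e j, rfl⟩
  · rintro ⟨j, rfl⟩
    exact ⟨e.symm j, by simp⟩

theorem bigHeckeAlgebra_comp_equiv (e : J' ≃ J) (δ : J → 𝒢) :
    bigHeckeAlgebra k ι T ϖ (δ ∘ e) = bigHeckeAlgebra k ι T ϖ δ := by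
  ext x
  change (∀ I : Finset TowerIndex, ∃ a ∈ towerHeckeAlgebra k ι T ϖ (δ ∘ e), ∀ y ∈ I, x y = a y) ↔
    (∀ I : Finset TowerIndex, ∃ a ∈ towerHeckeAlgebra k ι T ϖ δ, ∀ y ∈ I, x y = a y)
  rw [towerHeckeAlgebra_comp_equiv]

theorem isHeckePoint_comp_equiv (e : J' ≃ J) (δ : J → 𝒢) (χ : J → k) :
    IsHeckePoint ι T ϖ (δ ∘ e) (χ ∘ e) ↔ IsHeckePoint ι T ϖ δ χ := by
  have hB := bigHeckeAlgebra_comp_equiv ι T ϖ e δ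
  constructor
  · intro h t
    obtain ⟨I, φ, hcont, hgen⟩ := h t
    refine ⟨I, φ.comp (Subalgebra.equivOfEq _ _ hB.symm).toAlgHom, ?_, ?_⟩
    · intro x y hxy
      simp only [AlgHom.comp_apply]
      apply hcont
      intro z hz
      simpa using hxy z hz
    · intro j
      have h1 : ((Subalgebra.equivOfEq _ _ hB.symm).toAlgHom
          ⟨towerHeckeFamily k ι T ϖ (δ j), towerHeckeFamily_mem_bigHeckeAlgebra k ι T ϖ δ j⟩ :
            bigHeckeAlgebra k ι T ϖ (δ ∘ e)) =
          ⟨towerHeckeFamily k ι T ϖ ((δ ∘ e) (e.symm j)),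
            towerHeckeFamily_mem_bigHeckeAlgebra k ι T ϖ (δ ∘ e) (e.symm j)⟩ := by
        apply Subtype.ext
        simp
      have h2 := hgen (e.symm j)
      simp only [Function.comp_apply, Equiv.apply_symm_apply] at h2
      rw [AlgHom.comp_apply, h1]
      simpa using h2
  · intro h t
    obtain ⟨I, φ, hcont, hgen⟩ := h t
    refine ⟨I, φ.comp (Subalgebra.equivOfEq _ _ hB).toAlgHom, ?_, ?_⟩
    · intro x y hxy
      simp only [AlgHom.comp_apply]
      apply hcont
      intro z hz
      simpa using hxy z hz
    · intro j
      have h1 : ((Subalgebra.equivOfEq _ _ hB).toAlgHom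
          ⟨towerHeckeFamily k ι T ϖ ((δ ∘ e) j), towerHeckeFamily_mem_bigHeckeAlgebra k ι T ϖ (δ ∘ e) j⟩ :
            bigHeckeAlgebra k ι T ϖ δ) =
          ⟨towerHeckeFamily k ι T ϖ (δ (e j)), towerHeckeFamily_mem_bigHeckeAlgebra k ι T ϖ δ (e j)⟩ := by
        apply Subtype.ext
        simp
      rw [AlgHom.comp_apply, h1]
      exact hgen (e j)

end Literature.NumberTheory.Automorphic

namespace Summit.Langlands.Langlands.Cruxes.ArtinWeightRealisationLevel.EveryPlaceByGammaRigidity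

/-- The hypothesis package of R′ (`ArtinWeightRealisationLevel`) verbatim: `σ` is `p`-adically
automorphic of tame level `S₀` — `U` hyperspecial at the good places, a continuous
`𝒪_{ℚ̄_p}`-point of `Spf 𝕋(U^p)` of the `p`-power tower, Hansen-associated with `σ` at every good
place. -/
def HypLevel (K : Type) [Field K] [NumberField K] (p : ℕ) [Fact p.Prime]
    (σ : FramedGaloisRep K (PadicAlgCl p) 2) (S₀ : Finset ℕ) : Prop :=
  ∃ (U : Subgroup (GL (Fin 2) (IsDedekindDomain.FiniteAdeleRing (NumberField.RingOfIntegers K) K))) (ϖ : ∀ v : IsDedekindDomain.HeightOneSpectrum (NumberField.RingOfIntegers K), (v.adicCompletion K)ˣ) (a : {v : IsDedekindDomain.HeightOneSpectrum (NumberField.RingOfIntegers K) // ∀ ℓ ∈ S₀, ((ℓ : ℕ) : NumberField.RingOfIntegers K) ∉ v.asIdeal} → ℕ → (Valued.v (R := PadicAlgCl p)).valuationSubring), IsOpen (U : Set (GL (Fin 2) (IsDedekindDomain.FiniteAdeleRing (NumberField.RingOfIntegers K) K))) ∧ U ≤ Literature.NumberTheory.Automorphic.glFiniteIntegralLevel 2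 K ∧ (∀ g ∈ Literature.NumberTheory.Automorphic.glFiniteIntegralLevel 2 K, (∀ v : IsDedekindDomain.HeightOneSpectrum (NumberField.RingOfIntegers K), ¬ (∀ ℓ ∈ S₀, ((ℓ : ℕ) : NumberField.RingOfIntegers K) ∉ v.asIdeal) → ∀ i j : Fin 2, ((g : Matrix (Fin 2) (Fin 2) (IsDedekindDomain.FiniteAdeleRing (NumberField.RingOfIntegers K) K)) i j) v = (1 : Matrix (Fin 2) (Fin 2) (v.adicCompletion K)) i j) → g ∈ U) ∧ (∀ v : IsDedekindDomain.HeightOneSpectrum (NumberField.RingOfIntegers K), Valued.v ((ϖ v : (v.adicCompletion K)ˣ) : v.adicCompletion K) = WithZero.exp (-1 : ℤ)) ∧ Literature.NumberTheory.Automorphic.IsHeckePoint (Matrix.GeneralLinearGroup.map (n := Fin 2) (algebraMap K (IsDedekindDomain.FiniteAdeleRing (NumberField.RingOfIntegers K) K))) (Literature.NumberTheory.Automorphic.LevelTower.ofSeq U (fun r : ℕ => (Literature.NumberTheory.Automorphic.principalCongruenceLevel 2 K (Ideal.span {((p : ℕ) : NumberField.RingOfIntegers K)} ^ r)).map (Literature.NumberTheory.Automorphic.GLn.sndHom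 2 K))) ((p : ℕ) : (Valued.v (R := PadicAlgCl p)).valuationSubring) (fun j : {v : IsDedekindDomain.HeightOneSpectrum (NumberField.RingOfIntegers K) // ∀ ℓ ∈ S₀, ((ℓ : ℕ) : NumberField.RingOfIntegers K) ∉ v.asIdeal} × Fin 2 => Literature.NumberTheory.Automorphic.GLn.sndHom 2 K (Literature.NumberTheory.Automorphic.heckeDiagAt 2 K j.1.1 (ϖ j.1.1) (j.2.val + 1))) (fun j => a j.1 (j.2.val + 1)) ∧ ∀ (v : IsDedekindDomain.HeightOneSpectrum (NumberField.RingOfIntegers K)) (hv : ∀ ℓ ∈ S₀, ((ℓ : ℕ) : NumberField.RingOfIntegers K) ∉ v.asIdeal), σ.IsHeckeAssociatedAt v (fun i : ℕ => if i = 0 then (1 : PadicAlgCl p) else ((a ⟨v, hv⟩ i : (Valued.v (R := PadicAlgCl p)).valuationSubring) : PadicAlgCl p))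

/-- The hypothesis package of the shared a.e. crux R (`RuelleTorsionArtinWeight.ArtinWeightRealisation`,
stmt-Langlands-11057) verbatim: some `S`-good tame level, `S ⊇ {v ∣ p}`, association at every
`v ∉ S`. -/
def HypAE (K : Type) [Field K] [NumberField K] (p : ℕ) [Fact p.Prime]
    (σ : FramedGaloisRep K (PadicAlgCl p) 2) : Prop :=
  ∃ (S : Finset (IsDedekindDomain.HeightOneSpectrum (NumberField.RingOfIntegers K))) (U : Subgroup (GL (Fin 2) (IsDedekindDomain.FiniteAdeleRing (NumberField.RingOfIntegers K) K))) (ϖ : ∀ v : IsDedekindDomain.HeightOneSpectrum (NumberField.RingOfIntegers K), (v.adicCompletion K)ˣ) (a : {v : IsDedekindDomain.HeightOneSpectrum (NumberField.RingOfIntegers K) // v ∉ S} → ℕ → (Valued.v (R := PadicAlgCl p)).valuationSubring), (∀ v : IsDedekindDomain.HeightOneSpectrum (NumberField.RingOfIntegers K), ((p : ℕ) : NumberField.RingOfIntegers K) ∈ v.asIdeal → v ∈ S) ∧ IsOpen (U : Set (GL (Fin 2) (IsDedekindDomain.FiniteAdeleRing (NumberField.RingOfIntegers K) K))) ∧ U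 ≤ Literature.NumberTheory.Automorphic.glFiniteIntegralLevel 2 K ∧ (∀ g ∈ Literature.NumberTheory.Automorphic.glFiniteIntegralLevel 2 K, (∀ v ∈ S, ∀ i j : Fin 2, ((g : Matrix (Fin 2) (Fin 2) (IsDedekindDomain.FiniteAdeleRing (NumberField.RingOfIntegers K) K)) i j) v = (1 : Matrix (Fin 2) (Fin 2) (v.adicCompletion K)) i j) → g ∈ U) ∧ (∀ v : IsDedekindDomain.HeightOneSpectrum (NumberField.RingOfIntegers K), Valued.v ((ϖ v : (v.adicCompletion K)ˣ) : v.adicCompletion K) = WithZero.exp (-1 : ℤ)) ∧ Literature.NumberTheory.Automorphic.IsHeckePoint (Matrix.GeneralLinearGroup.map (n := Fin 2) (algebraMap K (IsDedekindDomain.FiniteAdeleRing (NumberField.RingOfIntegers K) K))) (Literature.NumberTheory.Automorphic.LevelTower.ofSeq U (fun r : ℕ => (Literature.NumberTheory.Automorphic.principalCongruenceLevel 2 K (Ideal.span {((p : ℕ) : NumberField.RingOfIntegers K)} ^ r)).map (Literature.NumberTheory.Automorphic.GLn.sndHom 2 K))) ((p : ℕ) : (Valued.v (R := PadicAlgCl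 p)).valuationSubring) (fun j : {v : IsDedekindDomain.HeightOneSpectrum (NumberField.RingOfIntegers K) // v ∉ S} × Fin 2 => Literature.NumberTheory.Automorphic.GLn.sndHom 2 K (Literature.NumberTheory.Automorphic.heckeDiagAt 2 K j.1.1 (ϖ j.1.1) (j.2.val + 1))) (fun j => a j.1 (j.2.val + 1)) ∧ ∀ (v : IsDedekindDomain.HeightOneSpectrum (NumberField.RingOfIntegers K)) (hv : v ∉ S), σ.IsHeckeAssociatedAt v (fun i : ℕ => if i = 0 then (1 : PadicAlgCl p) else ((a ⟨v, hv⟩ i : (Valued.v (R := PadicAlgCl p)).valuationSubring) : PadicAlgCl p))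

/-- Bookkeeping transfer: a pinned tame level `S₀ ∋ p` (rational primes) is an `S`-good tame level for
`S :=` the (finitely many) places of `K` over the primes of `S₀`; the eigenvalue family is re-indexed
along `{v // v ∉ S} ≃ {v // v good}` (same big Hecke algebra: it is generated by the range of the
family).  PROVED below (`levelToAE_holds`) for `0 ∉ S₀`; for `0 ∈ S₀` no place is good (`(0 : 𝓞 K)`
lies in every prime), the set of bad places is infinite and no `S` exists — the degenerate sector of
R′, where its conclusion is the bare existence of a cuspidal `π` on `GL₂(𝔸_K)` (`CuspFormsGL2Exist`). -/
def LevelToAE : Prop :=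
  ∀ (K : Type) [Field K] [NumberField K] (p : ℕ) [Fact p.Prime]
    (σ : FramedGaloisRep K (PadicAlgCl p) 2) (S₀ : Finset ℕ), p ∈ S₀ → 0 ∉ S₀ → HypLevel K p σ S₀ → HypAE K p σ

/-- **The lever (rigidity of a.e. matching).**  For `K` a number field, `σ : Γ_K → GL₂(ℚ̄_p)` with
finite image and irreducible, and `π` cuspidal on `GL₂(𝔸_K)`: if `π` is Satake–Frobenius compatible
with `σ` at all but finitely many places, then it is compatible with `σ` at EVERY finite place where
`σ` is unramified (in particular `π` is unramified there).  Proof in words: divide the global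
functional equations of `Λ(s, π ⊗ ω)` (Jacquet–Langlands Thm 11.1) and of `Λ(s, σ ⊗ ω)` (Artin,
Brauer–Hecke–Tate with the Langlands–Deligne local constants) for all idele class characters `ω`;
off a finite set `B` the local factors agree, so `∏_{w ∈ B ∪ ∞} γ(s, π_w ⊗ ω_w)/γ(s, σ_w ⊗ ω_w) = 1`;
choosing `ω` highly ramified at all places of `B` but one kills those quotients (stability of
`γ`-factors: JL Prop 3.8, Deligne), the archimedean quotient is then a finite Euler-type function,
which forces it to be constant and `π_∞` to be of Artin type `Ind(1,1)` (pole geometry of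
`Γ_ℂ`), and the surviving identity `γ(s, π_{w₀} ⊗ μ) = γ(s, σ_{w₀} ⊗ μ)` for all characters `μ` of
`K_{w₀}^×` gives `π_{w₀} ≅ π(σ_{w₀})` by the local converse theorem (JL Cor. 2.19) and local
Langlands for `GL₂` (Kutzko); at an unramified `w₀` this is the Satake–Frobenius compatibility.
[cite: JacquetLanglands1970, Thm 11.1, Prop 3.8, Cor 2.19] [cite: BookerKrishnamurthy2011, §5]
[cite: Booker2003] -/
def RigidityAE : Prop :=
  ∀ (K : Type) [Field K] [NumberField K] (p : ℕ) [Fact p.Prime] (ι : PadicAlgCl p ≃+* ℂ)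
    (σ : FramedGaloisRep K (PadicAlgCl p) 2), Finite σ.toMonoidHom.range → σ.toGaloisRep.IsIrreducible →
    ∀ (hcpt : isCompact_glFiniteIntegralLevel 2 K) (π : CuspidalAutomorphicRepData 2 K hcpt),
      (∀ᶠ w : HeightOneSpectrum (𝓞 K) in cofinite, Summit.Langlands.SatakeFrobCompatibleAt ι π.1 σ w) →
      ∀ w : HeightOneSpectrum (𝓞 K), σ.IsUnramifiedAt w → Summit.Langlands.SatakeFrobCompatibleAt ι π.1 σ w

/-- The degenerate sector `0 ∈ S₀` of R′ (no good place at all): its conclusion is then the bare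
existence of SOME cuspidal automorphic representation of `GL₂(𝔸_K)` — true (cusp forms exist on
`GL₂` over every number field: e.g. automorphic induction of a Hecke character of a quadratic
extension, or Weyl's law), a vendoring task of its own, recorded as a separate hypothesis so that the
reduction below is honest about it. [cite: JacquetLanglands1970, §12] -/
def CuspFormsGL2Exist : Prop :=
  ∀ (K : Type) [Field K] [NumberField K], NumberField.IsTotallyComplex K → Module.finrank ℚ K = 2 →
    ∃ hcpt : isCompact_glFiniteIntegralLevel 2 K, Nonempty (CuspidalAutomorphicRepData 2 K hcpt)

/-- `LevelToAE` is a theorem (bookkeeping): `S :=` the finitely many places over the primes of `S₀`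
(`Ideal.finite_factors`, `0 ∉ S₀`), same `U`, `ϖ`, the eigenvalue family re-indexed along
`{v // v ∉ S} × Fin 2 ≃ {v // v good} × Fin 2` (`isHeckePoint_comp_equiv`). -/
theorem levelToAE_holds : LevelToAE := by
  intro K _ _ p _ σ S₀ hp h0 h
  obtain ⟨U, ϖ, a, hopen, hle, hlev, hϖ, hpt, hassoc⟩ := h
  -- the finite set of bad places (those over a prime of `S₀`; finite because `0 ∉ S₀`)
  have hfin : {v : HeightOneSpectrum (𝓞 K) | ¬ ∀ ℓ ∈ S₀, ((ℓ : ℕ) : 𝓞 K) ∉ v.asIdeal}.Finite := by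
    have hsub : {v : HeightOneSpectrum (𝓞 K) | ¬ ∀ ℓ ∈ S₀, ((ℓ : ℕ) : 𝓞 K) ∉ v.asIdeal} ⊆
        ⋃ ℓ ∈ (S₀ : Set ℕ), {v : HeightOneSpectrum (𝓞 K) | v.asIdeal ∣ Ideal.span {((ℓ : ℕ) : 𝓞 K)}} := by
      intro v hv
      simp only [Set.mem_setOf_eq, not_forall, not_not, exists_prop] at hv
      obtain ⟨ℓ, hℓ, hmem⟩ := hv
      simp only [Set.mem_iUnion, Set.mem_setOf_eq, exists_prop]
      exact ⟨ℓ, hℓ, Ideal.dvd_span_singleton.mpr hmem⟩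
    refine Set.Finite.subset (Set.Finite.biUnion S₀.finite_toSet fun ℓ hℓ => ?_) hsub
    apply Ideal.finite_factors
    have hℓ0 : ℓ ≠ 0 := fun h => h0 (h ▸ hℓ)
    intro hbot
    rw [Submodule.zero_eq_bot, Ideal.span_singleton_eq_bot] at hbot
    exact (Nat.cast_ne_zero.mpr hℓ0) hbot
  have hS : ∀ v : HeightOneSpectrum (𝓞 K), v ∉ hfin.toFinset ↔ ∀ ℓ ∈ S₀, ((ℓ : ℕ) : 𝓞 K) ∉ v.asIdeal := by
    intro v
    rw [Set.Finite.mem_toFinset, Set.mem_setOf_eq, not_not]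
  -- the re-indexing equivalence `{v // v ∉ S} × Fin 2 ≃ {v // v good} × Fin 2`
  let e : {v : HeightOneSpectrum (𝓞 K) // v ∉ hfin.toFinset} × Fin 2 ≃
      {v : HeightOneSpectrum (𝓞 K) // ∀ ℓ ∈ S₀, ((ℓ : ℕ) : 𝓞 K) ∉ v.asIdeal} × Fin 2 :=
    (Equiv.subtypeEquivRight hS).prodCongr (Equiv.refl _)
  have key := (isHeckePoint_comp_equiv
      (Matrix.GeneralLinearGroup.map (n := Fin 2) (algebraMap K (FiniteAdeleRing (𝓞 K) K)))
      (LevelTower.ofSeq U (fun r : ℕ =>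
        (principalCongruenceLevel 2 K (Ideal.span {((p : ℕ) : 𝓞 K)} ^ r)).map (GLn.sndHom 2 K)))
      ((p : ℕ) : (Valued.v (R := PadicAlgCl p)).valuationSubring) e
      (fun j : {v : HeightOneSpectrum (𝓞 K) // ∀ ℓ ∈ S₀, ((ℓ : ℕ) : 𝓞 K) ∉ v.asIdeal} × Fin 2 =>
        GLn.sndHom 2 K (heckeDiagAt 2 K j.1.1 (ϖ j.1.1) (j.2.val + 1)))
      (fun j => a j.1 (j.2.val + 1))).mpr hpt
  refine ⟨hfin.toFinset, U, ϖ, fun v => a ⟨v.1, (hS v.1).mp v.2⟩, ?_, hopen, hle, ?_, hϖ, key, ?_⟩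
  · intro v hpv
    by_contra hvS
    exact (hS v).mp hvS p hp hpv
  · intro g hg hgS
    refine hlev g hg fun v hv => hgS v ?_
    by_contra hvS
    exact hv ((hS v).mp hvS)
  · intro v hv
    exact hassoc v ((hS v).mp hv)

/-- **Checked reduction.**  The route-local crux R′ (`ArtinWeightRealisationLevel`, every good
place, pinned level) follows from the shared a.e. crux R (`ArtinWeightRealisation`,
stmt-Langlands-11057) and the rigidity lemma `RigidityAE` — plus, in the degenerate sector
`0 ∈ S₀` (no good place), the bare existence of a cusp form `CuspFormsGL2Exist`.  The bookkeeping
`LevelToAE` is proved above; unramifiedness of `σ` at a good place is part of the association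
hypothesis (`IsHeckeAssociatedAt.isUnramifiedAt`).  Pure logic otherwise. -/
theorem crux_of_rigidity
    (hR : Summit.Langlands.Langlands.Theses.RuelleTorsionArtinWeight.ArtinWeightRealisation)
    (hRig : RigidityAE) (hCusp : CuspFormsGL2Exist) :
    Summit.Langlands.Langlands.Theses.ParityBlindBianchi.ArtinWeightRealisationLevel := by
  intro K _ _ htc hdeg p _ ι σ hfin hirr S₀ hp hyp
  have hyp' : HypLevel K p σ S₀ := hyp
  by_cases h0 : (0 : ℕ) ∈ S₀
  · -- degenerate sector: no place is good, the conclusion is the bare existence of a cuspidal π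
    obtain ⟨hcpt, ⟨π⟩⟩ := hCusp K htc hdeg
    refine ⟨hcpt, π, fun w hw => ?_⟩
    exact absurd (Ideal.zero_mem w.asIdeal) (by exact_mod_cast hw 0 h0)
  obtain ⟨hcpt, π, hae⟩ := hR K htc hdeg p ι σ hfin hirr (levelToAE_holds K p σ S₀ hp h0 hyp')
  refine ⟨hcpt, π, fun w hw => hRig K p ι σ hfin hirr hcpt π hae w ?_⟩
  obtain ⟨U, ϖ, a, -, -, -, -, -, hassoc⟩ := hyp'
  exact (hassoc w hw).isUnramifiedAt

end Summit.Langlands.Langlands.Cruxes.ArtinWeightRealisationLevel.EveryPlaceByGammaRigidity
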